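import Summits.QuantumFields.YangMills.Theorems.ConvexGribovBodyBrascampLiebVacuumSCCubeWitnessOfDimensionGap
import Literature.MathematicalPhysics.QuantumLattice.RepLieAlgebra
import Literature.Analysis.Calculus.ClosedSubgroupExpChart
import Mathlib.Analysis.Normed.Algebra.MatrixExponential
import Mathlib.Analysis.SpecialFunctions.Exponential

/-!
# Stub `stub_cartanChart` of the line `SketchIdeator1` for the crux `BrascampLiebVacuumSC`
# (stmt-QuantumFields-16404, route `ConvexGribovBody`)

The von Neumann–Cartan closed-subgroup theorem for the compact matrix group `H = ρ(G) ⊆ U(N)` of a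
faithful continuous unitary representation `r : LatticeRep G` of a compact group `G`, in the exact
shape consumed by `stub_gapAssembly`:

* the matrix Lie algebra `𝔥 = {X | exp(tX) ∈ ρ(G) ∀ t ∈ ℝ}` is (the carrier of) a real subspace
  `V` of `M_N(ℂ)` — Hall, Thm. 3.20; in the tree this is
  `Literature.MathematicalPhysics.QuantumLattice.coe_matrixLieAlgebra_eq` (Lie product formula) for
  the closed submonoid `Set.range r.ρ`, packaged as `repLieAlgebra r`;
* for every `s > 0` there is `η > 0` such that every `ρ(g)` with `‖ρ(g) − 1‖_F < η` is `exp X`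
  with `X ∈ 𝔥`, `‖X‖_F < s` — Hall, Thm. 3.42 / von Neumann 1929; in the tree this is
  `Literature.Analysis.Calculus.exists_exp_chart_range` (inverse function theorem for
  `Z ↦ exp(PZ) exp(Z − PZ)`, von Neumann's limit lemma and compactness of the unit sphere), which
  even gives `‖X‖_F ≤ 2‖ρ(g) − 1‖_F`, so `η = min r₀ (s/2)` works.

The only work here is bookkeeping: `froSq M = ‖M‖_F²` (`SupMeasurable.froSq_eq_norm_sq`, Mathlib's
scoped Frobenius norm `Matrix.Norms.Frobenius`) to pass between `froSq (·) < η²` and `‖·‖_F < η`.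
No named facts are used.
-/

set_option autoImplicit false

open scoped BigOperators Topology Matrix
open Filter
open Literature.MathematicalPhysics.QuantumFieldTheory
open Literature.MathematicalPhysics.QuantumLattice
open Summit.QuantumFields.YangMills.Cruxes.CovarianceBound.SupportWindow (froSq)

noncomputable section

namespace Summit.QuantumFields.YangMills.Theorems.BrascampLiebVacuumSC

namespace CartanChart

section Frobenius

open scoped Matrix.Norms.Frobenius
open Summit.QuantumFields.YangMills.Cruxes.CovarianceBound.SupportWindow.SupMeasurable
  (froSq_eq_norm_sq)

/-- `froSq M < η²` with `η > 0` gives `‖M‖_F < η` (Frobenius norm). [folklore] -/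
theorem norm_lt_of_froSq_lt {N : ℕ} {M : Matrix (Fin N) (Fin N) ℂ} {η : ℝ} (hη : 0 < η)
    (h : froSq M < η ^ 2) : ‖M‖ < η := by
  rw [froSq_eq_norm_sq] at h
  exact lt_of_pow_lt_pow_left₀ 2 hη.le h

/-- `‖M‖_F < s` gives `froSq M < s²`. [folklore] -/
theorem froSq_lt_of_norm_lt {N : ℕ} {M : Matrix (Fin N) (Fin N) ℂ} {s : ℝ} (h : ‖M‖ < s) :
    froSq M < s ^ 2 := by
  rw [froSq_eq_norm_sq]
  exact pow_lt_pow_left₀ h (norm_nonneg _) two_ne_zero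

/-- **The exponential chart fills `ρ(G)` near `1` (von Neumann 1929; Hall, Thm. 3.42)**, Frobenius
form with `froSq`: for every `s > 0` there is `η > 0` such that every `ρ(g)` with
`froSq (ρ g − 1) < η²` is `exp X` with `exp(ℝX) ⊆ ρ(G)` and `froSq X < s²`. From the tree's
`exists_exp_chart_range` (radius `r₀`, bound `‖X‖_F ≤ 2‖ρ g − 1‖_F`) with `η = min r₀ (s/2)`.
[cite: vonNeumann1929, §3] -/
theorem exists_eta {G : Type} [Group G] [TopologicalSpace G] [CompactSpace G] (r : LatticeRep G)
    {s : ℝ} (hs : 0 < s) :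
    ∃ η : ℝ, 0 < η ∧ ∀ g : G, froSq (r.ρ g - 1) < η ^ 2 →
      ∃ X : Matrix (Fin r.N) (Fin r.N) ℂ, (∀ t : ℝ, NormedSpace.exp (t • X) ∈ Set.range r.ρ) ∧
        froSq X < s ^ 2 ∧ NormedSpace.exp X = r.ρ g := by
  obtain ⟨r₀, hr₀, h⟩ := Literature.Analysis.Calculus.exists_exp_chart_range r.ρ r.continuous
  refine ⟨min r₀ (s / 2), lt_min hr₀ (half_pos hs), fun g hg => ?_⟩
  have hη : ‖r.ρ g - 1‖ < min r₀ (s / 2) := norm_lt_of_froSq_lt (lt_min hr₀ (half_pos hs)) hg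
  obtain ⟨X, hX, hXg, hXn⟩ := h g (lt_of_lt_of_le hη (min_le_left _ _))
  refine ⟨X, fun t => ?_, froSq_lt_of_norm_lt ?_, hXg⟩
  · obtain ⟨k, hk⟩ := hX t
    exact ⟨k, hk⟩
  · have h2 : ‖r.ρ g - 1‖ < s / 2 := lt_of_lt_of_le hη (min_le_right _ _)
    linarith

end Frobenius

end CartanChart

/-- **Stub (RESIDUAL F1 — von Neumann–Cartan closed-subgroup theorem for the compact matrix group
`H = ρ(G) ⊆ GL_N(ℂ)`).** For a compact group `G` with a faithful continuous unitary matrix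
representation `r`, the matrix Lie algebra `𝔥 = {X : exp(tX) ∈ ρ(G) ∀ t ∈ ℝ}` is (the carrier of)
an `ℝ`-subspace `V` of `M_N(ℂ)` (Hall, Thm. 3.20: `Ad`-stability, scaling, and closure under sums
by the Lie product formula — tree `coe_matrixLieAlgebra_eq`, `repLieAlgebra r`), and `exp` maps
every small Frobenius ball of `𝔥` ONTO a neighbourhood of `1` in `ρ(G)`: for every `s > 0` there is
`η > 0` with `ρ(G) ∩ {froSq (· − 1) < η²} ⊆ exp (𝔥 ∩ {froSq < s²})` (Hall, Thm. 3.42; von Neumann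
1929 — tree `exists_exp_chart_range`: the chart `Z ↦ exp(PZ) exp(Z − PZ)` is a local homeomorphism
at `0`, and transversal components of points of `ρ(G)` accumulating at `1` would produce, by the
limit lemma and compactness of the unit sphere, a unit vector of `𝔥 ∩ ker P = 0`).
[cite: Hall2015, Thm. 3.20 and Thm. 3.42] [cite: vonNeumann1929] -/
theorem stub_cartanChart :
    ∀ (G : Type) [Group G] [TopologicalSpace G] [CompactSpace G] (r : LatticeRep G),
      ∃ V : Submodule ℝ (Matrix (Fin r.N) (Fin r.N) ℂ),
        ((V : Set (Matrix (Fin r.N) (Fin r.N) ℂ)) =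
          {X | ∀ t : ℝ, NormedSpace.exp (t • X) ∈ Set.range r.ρ}) ∧
        ∀ s : ℝ, 0 < s → ∃ η : ℝ, 0 < η ∧ ∀ g : G, froSq (r.ρ g - 1) < η ^ 2 →
          ∃ X ∈ V, froSq X < s ^ 2 ∧ NormedSpace.exp X = r.ρ g := by
  intro G _ _ _ r
  have hV : ((repLieAlgebra r : Submodule ℝ (Matrix (Fin r.N) (Fin r.N) ℂ)) :
      Set (Matrix (Fin r.N) (Fin r.N) ℂ)) = {X | ∀ t : ℝ, NormedSpace.exp (t • X) ∈ Set.range r.ρ} :=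
    coe_matrixLieAlgebra_eq r.one_mem_range r.mul_mem_range r.isClosed_range
  refine ⟨repLieAlgebra r, hV, fun s hs => ?_⟩
  obtain ⟨η, hη, h⟩ := CartanChart.exists_eta r hs
  refine ⟨η, hη, fun g hg => ?_⟩
  obtain ⟨X, hX, hXs, hXg⟩ := h g hg
  refine ⟨X, ?_, hXs, hXg⟩
  rw [← SetLike.mem_coe, hV]
  exact hX

end Summit.QuantumFields.YangMills.Theorems.BrascampLiebVacuumSC

end
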